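import Summits.HodgeConjecture.HodgeConjecture.Theorems.AnchorTransportAnchorExistenceK3SquareCMFloorComplexification
import Literature.AlgebraicGeometry.Motives.HodgeStructurePseudoPolarizedProofs
import Literature.AlgebraicGeometry.Motives.HodgeStructureK3TypeIsometrySpan

/-!
# Route AnchorTransport — `AnchorExistence` (stmt-HodgeConjecture-1077), line `Sketch`, CM floor:
# the transcendental Hodge structure of a marked projective K3 surface, as a polarized Hodge
# structure of K3 type on the tree's abstract carriers

Marking picture (`Λ_ℚ = ℚ²²`, `k3FormRat`; `Λ_ℂ = ℂ²²`, `k3Form`): given a period `x ∈ Λ_ℂ`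
(`(x.x) = 0`, `(x̄.x) > 0`), the rational `(1,1)`-vectors `N = {v ∈ Λ_ℚ | (v.x) = (v.x̄) = 0}`
(`= NS(S)_ℚ` for a projective K3 surface `S`, by Lefschetz `(1,1)`) with `N ∩ N^⊥ = 0` (Hodge
index) and an ample vector `u ∈ N` (`(u.u) > 0`), this file CONSTRUCTS on `T := N^⊥ ≤ Λ_ℚ`
(Huybrechts, *Lectures on K3 Surfaces*, Ch. 3 Lemma 3.1: "`T(X) = NS(X)^⊥`") the weight-two
`ℚ`-Hodge structure of K3 type defined by the period (the tree's `HodgeStructure.ofPeriod`, with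
`T^{2,0} = ℂ x`, `T^{1,1} = x^⊥ ∩ x̄^⊥`, `T^{0,2} = ℂ x̄` under `ι_T : ℂ ⊗_ℚ T ≅ T_ℂ ⊂ Λ_ℂ`): the
splitting `Λ_ℚ = N ⊕ T` and its complexified projections (sums of rank-one maps), the period
`ω ∈ ℂ ⊗_ℚ T` with `ι_T ω = x`, `(ω.ω) = 0`, `(ω.ω̄) ≠ 0`, and the Hodge structure `hodgeT`, of K3
type. Its polarization `-( . )|_T` and its irreducibility (Lemma 3.1: "If `X` is projective, then
`T(X)` is a polarizable irreducible Hodge structure") follow in the sequel `…CMFloorPolarization`,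
after which Zarhin's theorems of the tree (`Zarhin1983_endAlg_isField_holds`,
`span_setOf_isometry_eq_top_of_conj_ne`) apply to `T`.

## References

* [Huybrechts2016K3] D. Huybrechts, Lectures on K3 Surfaces, CUP 2016, Ch. 3 §1.2 Def. 1.6,
  §2.2 Def. 2.3, Lemma 3.3.1, §3.3.3 Cor. 3.3.6, Thm. 3.3.7.
* [VoisinHodgeI2002] C. Voisin, Hodge Theory and Complex Algebraic Geometry I, CUP 2002, §7.1.
-/

noncomputable section

set_option linter.dupNamespace false

open scoped TensorProduct
open Module
open Literature.AlgebraicGeometry.Surfaces Literature.AlgebraicGeometry.Motives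
open Literature.AlgebraicGeometry.Motives.HodgeStructure
open Summit.HodgeConjecture.HodgeConjecture.Theorems.NikulinTwinTransport

namespace Summit.HodgeConjecture.HodgeConjecture.Theorems.AnchorExistenceCMFloor

/-! ### The splitting `Λ_ℚ = N ⊕ T`, `T = N^⊥` -/

section Splitting

variable {N : Submodule ℚ (K3Index → ℚ)} (hdisj : Disjoint N (k3FormRat.orthogonal N))
include hdisj

/-- **`Λ_ℚ = N ⊕ N^⊥`** as soon as `N ∩ N^⊥ = 0` (the cup form is non-degenerate on `NS(S)_ℚ` by
the Hodge index theorem). [cite: Huybrechts2016K3, Ch. 3 Lemma 3.3.1] -/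
theorem isCompl_orthogonal : IsCompl N (k3FormRat.orthogonal N) :=
  (LinearMap.BilinForm.isCompl_orthogonal_iff_disjoint k3FormRat_isSymm.isRefl).2 hdisj

/-- `N^⊥⊥ = N`, so `T = N^⊥` meets its own orthogonal `N` trivially. [folklore] -/
theorem disjoint_orthogonal_orthogonal :
    Disjoint (k3FormRat.orthogonal N) (k3FormRat.orthogonal (k3FormRat.orthogonal N)) := by
  rw [LinearMap.BilinForm.orthogonal_orthogonal k3FormRat_nondegenerate k3FormRat_isSymm.isRefl]
  exact hdisj.symm

/-- **The form restricted to `T = N^⊥` is non-degenerate.** [cite: Huybrechts2016K3, Ch. 3 Lemma 3.3.1] -/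
theorem restrict_orthogonal_nondegenerate :
    (k3FormRat.restrict (k3FormRat.orthogonal N)).Nondegenerate :=
  k3FormRat.nondegenerate_restrict_of_disjoint_orthogonal k3FormRat_isSymm.isRefl
    (disjoint_orthogonal_orthogonal hdisj)

/-- **The projection onto `N` along `T` is a sum of rank-one maps `v ↦ (v.aᵢ) dᵢ`, `aᵢ, dᵢ ∈ N`**,
and so is its complexification. [folklore] -/
theorem exists_cxEnd_projection_eq_sum :
    ∃ (m : ℕ) (a d : Fin m → K3Index → ℚ), (∀ i, a i ∈ N) ∧ (∀ i, d i ∈ N) ∧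
      (∀ v, N.projection _ (isCompl_orthogonal hdisj) v = ∑ i, k3FormRat v (a i) • d i) ∧
      ∀ z : K3Index → ℂ, cxEnd (N.projection _ (isCompl_orthogonal hdisj)) z =
        ∑ i, k3Form z (fun j => (a i j : ℂ)) • fun j => (d i j : ℂ) := by
  have hc := isCompl_orthogonal hdisj
  obtain ⟨m, a, d, ha, hd, hsum⟩ := exists_eq_sum_rankOne k3FormRat_isSymm k3FormRat_nondegenerate N
    (N.projection _ hc) (fun v => Submodule.projection_apply_mem hc v)
    (fun t ht => Submodule.projection_apply_of_mem_right hc ht)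
  refine ⟨m, a, d, ha, hd, hsum, fun z => ?_⟩
  have h : cxEnd (N.projection _ hc) =
      ∑ i, (k3FormC.flip (fun j => (a i j : ℂ))).smulRight (fun j => (d i j : ℂ)) := by
    symm
    refine eq_cxEnd_of_forall fun v => ?_
    rw [hsum v, ratCastΛ_sum]
    simp only [LinearMap.sum_apply, LinearMap.smulRight_apply, LinearMap.BilinForm.flip_apply, k3FormC_apply,
      k3Form_ratCast, ratCastΛ_smul]
  rw [h]
  simp only [LinearMap.sum_apply, LinearMap.smulRight_apply, LinearMap.BilinForm.flip_apply, k3FormC_apply]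

end Splitting

/-! ### The period data and the rational `(1,1)`-vectors -/

section Period

variable {x : K3Index → ℂ} {N : Submodule ℚ (K3Index → ℚ)}

/-- Vectors of `N` are orthogonal to the period. [folklore] -/
theorem k3Form_period_of_mem (hN : ∀ v : K3Index → ℚ, v ∈ N ↔
      k3Form (fun i => (v i : ℂ)) x = 0 ∧ k3Form (fun i => (v i : ℂ)) (star x) = 0)
    {n : K3Index → ℚ} (hn : n ∈ N) :
    k3Form x (fun i => (n i : ℂ)) = 0 ∧ k3Form (star x) (fun i => (n i : ℂ)) = 0 := by
  obtain ⟨h1, h2⟩ := (hN n).1 hn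
  exact ⟨by rw [k3Form_comm, h1], by rw [k3Form_comm, h2]⟩

/-- **The complexified projection onto `N` takes values orthogonal to `x` and `x̄`** (they lie in
`N_ℂ`). [cite: Huybrechts2016K3, Ch. 3 Lemma 3.3.1] -/
theorem k3Form_cxEnd_projection (hN : ∀ v : K3Index → ℚ, v ∈ N ↔
      k3Form (fun i => (v i : ℂ)) x = 0 ∧ k3Form (fun i => (v i : ℂ)) (star x) = 0)
    (hdisj : Disjoint N (k3FormRat.orthogonal N)) (z : K3Index → ℂ) :
    k3Form (cxEnd (N.projection _ (isCompl_orthogonal hdisj)) z) x = 0 ∧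
      k3Form (cxEnd (N.projection _ (isCompl_orthogonal hdisj)) z) (star x) = 0 := by
  obtain ⟨m, a, d, -, hd, -, hsum⟩ := exists_cxEnd_projection_eq_sum hdisj
  rw [hsum z, k3Form_sum_left, k3Form_sum_left]
  constructor
  · refine Finset.sum_eq_zero fun i _ => ?_
    rw [k3Form_smul_left, ((hN _).1 (hd i)).1, mul_zero]
  · refine Finset.sum_eq_zero fun i _ => ?_
    rw [k3Form_smul_left, ((hN _).1 (hd i)).2, mul_zero]

/-- **The complexified projection onto `N` kills every vector orthogonal to `N`.** [folklore] -/
theorem cxEnd_projection_eq_zero (hdisj : Disjoint N (k3FormRat.orthogonal N)) {z : K3Index → ℂ}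
    (hz : ∀ n ∈ N, k3Form z (fun i => (n i : ℂ)) = 0) :
    cxEnd (N.projection _ (isCompl_orthogonal hdisj)) z = 0 := by
  obtain ⟨m, a, d, ha, -, -, hsum⟩ := exists_cxEnd_projection_eq_sum hdisj
  rw [hsum z]
  exact Finset.sum_eq_zero fun i _ => by rw [hz _ (ha i), zero_smul]

/-- In particular the complexified projection onto `N` kills the period `x`. [folklore] -/
theorem cxEnd_projection_period (hN : ∀ v : K3Index → ℚ, v ∈ N ↔
      k3Form (fun i => (v i : ℂ)) x = 0 ∧ k3Form (fun i => (v i : ℂ)) (star x) = 0)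
    (hdisj : Disjoint N (k3FormRat.orthogonal N)) :
    cxEnd (N.projection _ (isCompl_orthogonal hdisj)) x = 0 :=
  cxEnd_projection_eq_zero hdisj fun _ hn => (k3Form_period_of_mem hN hn).1

variable (x) in
/-- **The period as an element `ω` of the abstract complexification `ℂ ⊗_ℚ T`** (`ι_T ω = x`).
[cite: Huybrechts2016K3, Ch. 3 §2.2 Def. 2.5] -/
def omega (hdisj : Disjoint N (k3FormRat.orthogonal N)) : ℂ ⊗[ℚ] (k3FormRat.orthogonal N) :=
  lam (isCompl_orthogonal hdisj) x

/-- `ι_T ω = x`: the period lies in `T_ℂ`. [cite: Huybrechts2016K3, Ch. 3 §2.2 Def. 2.5] -/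
theorem iota_omega (hN : ∀ v : K3Index → ℚ, v ∈ N ↔
      k3Form (fun i => (v i : ℂ)) x = 0 ∧ k3Form (fun i => (v i : ℂ)) (star x) = 0)
    (hdisj : Disjoint N (k3FormRat.orthogonal N)) : iota _ (omega x hdisj) = x :=
  iota_lam_of_proj_eq_zero _ (cxEnd_projection_period hN hdisj)

/-- `ι_T (conj ω) = x̄`. [folklore] -/
theorem iota_conj_omega (hN : ∀ v : K3Index → ℚ, v ∈ N ↔
      k3Form (fun i => (v i : ℂ)) x = 0 ∧ k3Form (fun i => (v i : ℂ)) (star x) = 0)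
    (hdisj : Disjoint N (k3FormRat.orthogonal N)) : iota _ (conj (omega x hdisj)) = star x := by
  rw [iota_conj, iota_omega hN hdisj]

/-- `(x.x̄)` is the positive real number `(x̄.x).re`, hence non-zero. [cite: Huybrechts2016K3, Ch. 6 §1.1] -/
theorem k3Form_self_star_period (hxpos : 0 < (k3Form (star x) x).re) :
    k3Form x (star x) = ((k3Form (star x) x).re : ℂ) ∧ k3Form x (star x) ≠ 0 := by
  have him : (k3Form (star x) x).im = 0 := k3Form_star_self_im x
  have hre : k3Form (star x) x = ((k3Form (star x) x).re : ℂ) := by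
    apply Complex.ext
    · simp
    · simp [him]
  rw [k3Form_comm]
  refine ⟨hre, fun h0 => ?_⟩
  rw [h0, Complex.zero_re] at hxpos
  exact lt_irrefl _ hxpos

/-- `(ω.ω) = 0` for the restricted form. [cite: Huybrechts2016K3, Ch. 6 Prop. 1.2 (i)] -/
theorem form_omega_omega (hN : ∀ v : K3Index → ℚ, v ∈ N ↔
      k3Form (fun i => (v i : ℂ)) x = 0 ∧ k3Form (fun i => (v i : ℂ)) (star x) = 0)
    (hdisj : Disjoint N (k3FormRat.orthogonal N)) (hxx : k3Form x x = 0) :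
    (k3FormRat.restrict (k3FormRat.orthogonal N)).baseChange ℂ (omega x hdisj) (omega x hdisj) = 0 := by
  rw [restrict_baseChange_apply, iota_omega hN hdisj, hxx]

/-- `(ω.ω̄) ≠ 0` for the restricted form. [cite: Huybrechts2016K3, Ch. 6 Prop. 1.2 (ii)] -/
theorem form_omega_conj_ne (hN : ∀ v : K3Index → ℚ, v ∈ N ↔
      k3Form (fun i => (v i : ℂ)) x = 0 ∧ k3Form (fun i => (v i : ℂ)) (star x) = 0)
    (hdisj : Disjoint N (k3FormRat.orthogonal N)) (hxpos : 0 < (k3Form (star x) x).re) :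
    (k3FormRat.restrict (k3FormRat.orthogonal N)).baseChange ℂ (omega x hdisj) (conj (omega x hdisj)) ≠ 0 := by
  rw [restrict_baseChange_apply, iota_omega hN hdisj, iota_conj_omega hN hdisj]
  exact (k3Form_self_star_period hxpos).2

/-- **The transcendental Hodge structure**: the weight-two Hodge structure of K3 type on
`T = N^⊥ ≤ Λ_ℚ` defined by the period `x` (`F² = ℂω`, `F¹ = ω^⊥`).
[cite: Huybrechts2016K3, Ch. 3 §2.2 Def. 2.3, Def. 2.5 and Lemma 3.3.1] -/
def hodgeT (hN : ∀ v : K3Index → ℚ, v ∈ N ↔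
      k3Form (fun i => (v i : ℂ)) x = 0 ∧ k3Form (fun i => (v i : ℂ)) (star x) = 0)
    (hdisj : Disjoint N (k3FormRat.orthogonal N)) (hxx : k3Form x x = 0)
    (hxpos : 0 < (k3Form (star x) x).re) : HodgeStructure (k3FormRat.orthogonal N) 2 :=
  ofPeriod (k3FormRat.restrict (k3FormRat.orthogonal N)) (omega x hdisj)
    (form_omega_omega hN hdisj hxx) (form_omega_conj_ne hN hdisj hxpos)

/-- The transcendental Hodge structure is of K3 type. [cite: Huybrechts2016K3, Ch. 3 Def. 2.3] -/
theorem isOfK3Type_hodgeT (hN : ∀ v : K3Index → ℚ, v ∈ N ↔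
      k3Form (fun i => (v i : ℂ)) x = 0 ∧ k3Form (fun i => (v i : ℂ)) (star x) = 0)
    (hdisj : Disjoint N (k3FormRat.orthogonal N)) (hxx : k3Form x x = 0)
    (hxpos : 0 < (k3Form (star x) x).re) : (hodgeT hN hdisj hxx hxpos).IsOfK3Type :=
  isOfK3Type_ofPeriod _ _

/-- `ω ≠ 0`. [folklore] -/
theorem omega_ne_zero (hN : ∀ v : K3Index → ℚ, v ∈ N ↔
      k3Form (fun i => (v i : ℂ)) x = 0 ∧ k3Form (fun i => (v i : ℂ)) (star x) = 0)
    (hdisj : Disjoint N (k3FormRat.orthogonal N)) (hxpos : 0 < (k3Form (star x) x).re) :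
    omega x hdisj ≠ 0 :=
  ne_zero_of_period (form_omega_conj_ne hN hdisj hxpos)

/-- The period generates `T^{2,0}`: the piece `(2,0)` of the transcendental Hodge structure is the
line `ℂ ω` ("`dim_ℂ V^{2,0} = 1`"). [cite: Huybrechts2016K3, Ch. 3 Def. 2.3 and Def. 2.5] -/
theorem piece_two_zero_hodgeT (hN : ∀ v : K3Index → ℚ, v ∈ N ↔
      k3Form (fun i => (v i : ℂ)) x = 0 ∧ k3Form (fun i => (v i : ℂ)) (star x) = 0)
    (hdisj : Disjoint N (k3FormRat.orthogonal N)) (hxx : k3Form x x = 0)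
    (hxpos : 0 < (k3Form (star x) x).re) :
    (hodgeT hN hdisj hxx hxpos).piece 2 0 = ℂ ∙ omega x hdisj :=
  piece_two_zero_ofPeriod _ _

end Period

end Summit.HodgeConjecture.HodgeConjecture.Theorems.AnchorExistenceCMFloor

end
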